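import Literature.AlgebraicGeometry.Resolution.MacaulayficationSecantSequences
import HarnessLib

/-!
# Schenzel's ideal `𝔯(M)` and colon-secant sequences

Topic: `Literature/AlgebraicGeometry/Resolution` (vocabulary of the commutative-algebra input of
Kawasaki's Macaulayfication [Kawasaki2000, §2] / Česnavičius's CM-secant sequences
[Cesnavicius2021, §3]; the existence theorems are in `SecantColonAnnihilatorExistence.lean`).

Schenzel [Schenzel1982, §2.4, after Lemma 2.4.4] denotes by `𝔯(M)` the intersection of the
annihilators of the *parameter colon modules* `((x₁,…,x_{k-1})M :_M x_k)/(x₁,…,x_{k-1})M` over all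
systems of parameters `x` of the finite module `M` over a Noetherian local ring and all `k`; we
phrase it through secant sequences in `𝔪` (= parts of systems of parameters,
`MacaulayficationSecantSequences.lean`): `secantColonAnnihilator S M`.

* `secantColonAnnihilator S M` — Schenzel's `𝔯(M)`; `mem_secantColonAnnihilator_iff`.
* `IsColonSecantSequence M rs` — `r₁,…,r_s ∈ 𝔪` secant for `M` with `rᵢ ∈ 𝔯(M/(r₁,…,rᵢ₋₁)M)`:
  the colon form of Česnavičius's **CM-secant sequences** [Cesnavicius2021, Def. 3.1 (ii)] (there
  `rᵢ ∈ ∏_{j < dim} Ann H^j_𝔪(M/(r₁,…,rᵢ₋₁)M)`, which implies the colon condition by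
  [Schenzel1982, Satz 2.4.2]) and, in reversed order, of Kawasaki's **`p`-standard systems of
  parameters** [Kawasaki2000, Def. 2.6].

[cite: Schenzel1982, §2.4 (after Lemma 2.4.4); Cesnavicius2021, Def. 3.1 (ii); Kawasaki2000, Def. 2.6]
-/
noncomputable section

open IsLocalRing Ideal Module

universe u v

namespace Literature.AlgebraicGeometry.Resolution

variable {S : Type u} [CommRing S]

/-! ## Schenzel's `𝔯(M)` -/

section Def

variable (S) [IsLocalRing S] (M : Type v) [AddCommGroup M] [Module S M]

/-- **Schenzel's ideal `𝔯(M)`**: the elements `c ∈ S` with `c · ((r₁,…,rᵢ)M :_M r_{i+1}) ⊆ (r₁,…,rᵢ)M`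
for every secant sequence `r₁, …, r_s ∈ 𝔪` of `M` and every `i < s` — i.e. the intersection of the
annihilators of all parameter colon modules `((x₁,…,x_{k-1})M : x_k)/(x₁,…,x_{k-1})M` over all
(parts of) systems of parameters of `M`. [cite: Schenzel1982, §2.4 (after Lemma 2.4.4)] -/
def secantColonAnnihilator : Ideal S where
  carrier := {c | ∀ ⦃rs : List S⦄, IsSecantSequence M rs → (∀ r ∈ rs, r ∈ maximalIdeal S) →
    ∀ ⦃i : ℕ⦄ (hi : i < rs.length) ⦃m : M⦄,
      rs[i] • m ∈ (ofList (rs.take i) • ⊤ : Submodule S M) →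
        c • m ∈ (ofList (rs.take i) • ⊤ : Submodule S M)}
  add_mem' ha hb := fun rs hrs hmem i hi m hm => by
    rw [add_smul]
    exact Submodule.add_mem _ (ha hrs hmem hi hm) (hb hrs hmem hi hm)
  zero_mem' := fun rs hrs hmem i hi m hm => by
    rw [zero_smul]
    exact Submodule.zero_mem _
  smul_mem' c a ha := fun rs hrs hmem i hi m hm => by
    rw [smul_eq_mul, mul_smul]
    exact Submodule.smul_mem _ c (ha hrs hmem hi hm)

variable {S M}

/-- Membership in `𝔯(M)`. [folklore] -/
theorem mem_secantColonAnnihilator_iff (c : S) :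
    c ∈ secantColonAnnihilator S M ↔
      ∀ ⦃rs : List S⦄, IsSecantSequence M rs → (∀ r ∈ rs, r ∈ maximalIdeal S) →
        ∀ ⦃i : ℕ⦄ (hi : i < rs.length) ⦃m : M⦄,
          rs[i] • m ∈ (ofList (rs.take i) • ⊤ : Submodule S M) →
            c • m ∈ (ofList (rs.take i) • ⊤ : Submodule S M) :=
  Iff.rfl

/-- For the zero module `𝔯(M) = S`. [folklore] -/
theorem secantColonAnnihilator_eq_top_of_subsingleton [Subsingleton M] :
    secantColonAnnihilator S M = ⊤ := by
  refine eq_top_iff.mpr fun c _ rs _ _ i _ m _ => ?_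
  rw [Subsingleton.elim m 0, smul_zero]
  exact Submodule.zero_mem _

end Def

/-! ## Colon-secant sequences (CM-secant / `p`-standard, colon form) -/

section ColonSecant

variable [IsLocalRing S] (M : Type v) [AddCommGroup M] [Module S M]

/-- **Colon-secant sequences**: `r₁, …, r_s ∈ 𝔪` is *colon-secant* for `M` if it is secant for `M`
and `rᵢ ∈ 𝔯(M/(r₁, …, rᵢ₋₁)M)` for all `i` — the colon form of CM-secant sequences
[Cesnavicius2021, Def. 3.1 (ii)] (whose condition `rᵢ ∈ ∏_{j<dim} Ann H^j_𝔪(M/(r₁,…,rᵢ₋₁)M)`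
implies this one by [Schenzel1982, Satz 2.4.2]) and, in reversed order, of Kawasaki's `p`-standard
sequences [Kawasaki2000, Def. 2.6]. [cite: Cesnavicius2021, Def. 3.1 (ii)] -/
def IsColonSecantSequence (rs : List S) : Prop :=
  IsSecantSequence M rs ∧ (∀ r ∈ rs, r ∈ maximalIdeal S) ∧
    ∀ (i : ℕ) (hi : i < rs.length),
      rs[i] ∈ secantColonAnnihilator S (M ⧸ (ofList (rs.take i) • ⊤ : Submodule S M))

variable {M}

/-- The empty sequence is colon-secant. [folklore] -/
theorem IsColonSecantSequence.nil : IsColonSecantSequence M ([] : List S) :=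
  ⟨IsSecantSequence.nil, fun _ h => absurd h List.not_mem_nil, fun i hi => absurd hi (by simp)⟩

/-- Unfolding. [folklore] -/
theorem IsColonSecantSequence.isSecantSequence {rs : List S} (h : IsColonSecantSequence M rs) :
    IsSecantSequence M rs := h.1

/-- Unfolding. [folklore] -/
theorem IsColonSecantSequence.mem_maximalIdeal {rs : List S} (h : IsColonSecantSequence M rs) :
    ∀ r ∈ rs, r ∈ maximalIdeal S := h.2.1

/-- Unfolding. [folklore] -/
theorem IsColonSecantSequence.getElem_mem {rs : List S} (h : IsColonSecantSequence M rs)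
    {i : ℕ} (hi : i < rs.length) :
    rs[i] ∈ secantColonAnnihilator S (M ⧸ (ofList (rs.take i) • ⊤ : Submodule S M)) := h.2.2 i hi

end ColonSecant

end Literature.AlgebraicGeometry.Resolution

end
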